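import Mathlib
import HarnessLib
import Summits.NavierStokesRegularity.NavierStokesRegularity.Theorems.PoloidalWindowRigidity.Negative.TriWaveProfile
import Summits.NavierStokesRegularity.NavierStokesRegularity.Theorems.PoloidalWindowRigidity.Negative.DriftProfileNoPeriod

/-!
# Crux `PoloidalWindowRigidity` (K2, stmt-NavierStokesRegularity-19708) — negative side:
# genericity clauses of the residue stub S2⁗ for the three-wave profile, I

Negative-side support (refuter seat ns-regularity-refuter1 gen 2, cell ns-regularity-ideate; D-0081 §C), sequel of
`…Negative.TriWaveProfile`.  For the three-wave profile `v = triProfile` (field `T = (2cos u, 2cos w + 2cos p,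
−2cos u + 2cos w − 2cos p)`, `u = x₀+x₂`, `w = x₁−x₂`, `p = x₁+x₂`) the following exclusions of S2⁗ hold on every
slice, by explicit evaluation at lattice points of the similarity variable:

* (7) the vorticity direction is constant on no slice (`ω ∥ (−8,4,0)` and `ω ∥ (0,−4,0)` at two points);
* (8) not vertically rigid; (9) `v·e₂` flat in no horizontal direction; (iv) super-critical horizontal strain
  (`(−s)⟪Dv e₀, e₀⟫ = 2` where `sin u = −1`); (12) not scale-invariant (`0 < log 4 < 2π`);
* (10), (13), (v′) no translation invariance, no vertical period, no common period: `T(mℓ) = T(0)` for all real `m`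
  forces `ℓ = 0` (`eq_zero_of_triField_smul_eq`), and a common period of all slices `s = −1/c²` gives exactly that.

WHAT THIS IS NOT: not a claim about Navier–Stokes — kinematics of an explicit profile; the crux K2 stays open.
[folklore]
-/

noncomputable section

-- the summit and its single sub-problem share the name (CONVENTIONS §1), as in every Theorems file
set_option linter.dupNamespace false

namespace Summit.NavierStokesRegularity.NavierStokesRegularity.Theorems.PoloidalWindowRigidity.Negative

open MeasureTheory Set Function Filter Topology Metric
open scoped RealInnerProductSpace InnerProductSpace ENNReal NNReal
open Literature.Analysis Literature.Analysis.FluidPDE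


/-! ## Genericity clauses of the residue for the three-wave profile -/

/-- A point with prescribed similarity variable: `A_s (c_s^{-1}(X − log(−s)e₁)) = X`. [folklore] -/
theorem triProfile_at_invPoint {s : ℝ} (hs : s < 0) (X : EuclideanSpace ℝ (Fin 3)) :
    triProfile s ((cellAmp s)⁻¹ • (X - Real.log (-s) • (EuclideanSpace.single (1 : Fin 3) (1 : ℝ)))) = cellAmp s •
        triField X := by
  rw [triProfile, driftShift_invPoint hs]

/-- (7) vorticity direction constant on no slice: for `b ≠ 0` some `curl v(s)(x) × b ≠ 0` (at the `A_s`-preimages of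
`−(π/2)e₂` and `(π/2)e₂` the vorticity is `(−s)^{-1}(−8, 4, 0)` and `(−s)^{-1}(8, 4, 0)`). [folklore] -/
theorem vorticityDirection_nonconstant_triProfile {s : ℝ} (hs : s < 0) (b : EuclideanSpace ℝ (Fin 3)) (hb : b ≠ 0) :
    ∃ x : EuclideanSpace ℝ (Fin 3), cross (curl (triProfile s) x) b ≠ 0 := by
  by_contra hcon
  simp only [not_exists, ne_eq, not_not] at hcon
  have hamp := (cellAmp_pos hs).ne'
  have key : ∀ X : EuclideanSpace ℝ (Fin 3),
      cross ((cellAmp s ^ 2 * (-4 * Real.sin (X 1 - X 2) + 4 * Real.sin (X 1 + X 2))) • (EuclideanSpace.single (0 :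
          Fin 3) (1 : ℝ)) +
        (cellAmp s ^ 2 * (-4 * Real.sin (X 0 + X 2))) • (EuclideanSpace.single (1 : Fin 3) (1 : ℝ))) b = 0 := by
    intro X
    have h := hcon ((cellAmp s)⁻¹ • (X - Real.log (-s) • (EuclideanSpace.single (1 : Fin 3) (1 : ℝ))))
    rwa [curl_triProfile, driftShift_invPoint hs] at h
  have h1 := key ((-(Real.pi / 2)) • (EuclideanSpace.single (2 : Fin 3) (1 : ℝ)))
  have h2 := key ((Real.pi / 2) • (EuclideanSpace.single (0 : Fin 3) (1 : ℝ)))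
  have p0 : ((-(Real.pi / 2)) • (EuclideanSpace.single (2 : Fin 3) (1 : ℝ)) : EuclideanSpace ℝ (Fin 3)) 0 = 0 := by
      simp
  have p1 : ((-(Real.pi / 2)) • (EuclideanSpace.single (2 : Fin 3) (1 : ℝ)) : EuclideanSpace ℝ (Fin 3)) 1 = 0 := by
      simp
  have p2 : ((-(Real.pi / 2)) • (EuclideanSpace.single (2 : Fin 3) (1 : ℝ)) : EuclideanSpace ℝ (Fin 3)) 2 = -(Real.pi
      / 2) := by simp
  have q0 : ((Real.pi / 2) • (EuclideanSpace.single (0 : Fin 3) (1 : ℝ)) : EuclideanSpace ℝ (Fin 3)) 0 = Real.pi / 2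
      := by simp
  have q1 : ((Real.pi / 2) • (EuclideanSpace.single (0 : Fin 3) (1 : ℝ)) : EuclideanSpace ℝ (Fin 3)) 1 = 0 := by simp
  have q2 : ((Real.pi / 2) • (EuclideanSpace.single (0 : Fin 3) (1 : ℝ)) : EuclideanSpace ℝ (Fin 3)) 2 = 0 := by simp
  simp only [p0, p1, p2, q0, q1, q2, zero_add, zero_sub, add_zero, sub_zero, neg_neg, Real.sin_pi_div_two,
    Real.sin_neg, Real.sin_zero] at h1 h2
  norm_num at h1 h2
  have h1b := congrArg (fun w : EuclideanSpace ℝ (Fin 3) => w 2) h1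
  have h2a := congrArg (fun w : EuclideanSpace ℝ (Fin 3) => w 0) h2
  have h2b := congrArg (fun w : EuclideanSpace ℝ (Fin 3) => w 2) h2
  simp [cross, cross_apply, hamp] at h1b h2a h2b
  apply hb
  ext i
  fin_cases i
  · simpa using h2b
  · show b 1 = 0
    have hc2 : cellAmp s ^ 2 ≠ 0 := pow_ne_zero 2 hamp
    rw [h2b, mul_zero, neg_zero, add_zero, neg_eq_zero] at h1b
    simpa [hc2] using h1b
  · simpa using h2a

/-- (8) not vertically rigid on any slice: `(Dv(s) e₂)₀ = −2(−s)^{-1}` at the `A_s`-preimage of `(π/2)e₀`.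
[folklore] -/
theorem not_vertRigid_triProfile {s : ℝ} (hs : s < 0) :
    ∃ x : EuclideanSpace ℝ (Fin 3), fderiv ℝ (triProfile s) x (EuclideanSpace.single (2 : Fin 3) (1 : ℝ)) 0 ≠ 0 := by
  refine ⟨(cellAmp s)⁻¹ • ((Real.pi / 2) • (EuclideanSpace.single (0 : Fin 3) (1 : ℝ)) - Real.log (-s) •
      (EuclideanSpace.single (1 : Fin 3) (1 : ℝ))), ?_⟩
  rw [fderiv_triProfile_apply, driftShift_invPoint hs, triDeriv_apply_zero]
  simp [(cellAmp_pos hs).ne']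

/-- (viii) [rev 11] no slice is elliptic-shear-pinched: the three-wave field is HYPERBOLIC-shear-pinched,
`∂₂T_h = −∇_h T₂` identically (`T_h = ∇_h φ`, `T₂ = −∂₂φ`), so at the `A_s`-preimage of `(π/2)e₀` (`sin u = 1`) one has
`∂₂v₀ = −2c_s² < 0 < 2m c_s² = m ∂₀v₂` for every `m > 0`: the first alternative of clause (viii) holds for all
`m ∈ [μ₀, μ₁]`, `μ₀ > 0`. [folklore] -/
theorem not_ellipticShearPinched_triProfile {s : ℝ} (hs : s < 0) (μ₀ μ₁ : ℝ) (hμ₀ : 0 < μ₀) :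
    ∃ y : EuclideanSpace ℝ (Fin 3), ∀ m : ℝ, μ₀ ≤ m → m ≤ μ₁ →
      fderiv ℝ (triProfile s) y (EuclideanSpace.single 2 1) 0 ≠
          m * fderiv ℝ (triProfile s) y (EuclideanSpace.single 0 1) 2 ∨
        fderiv ℝ (triProfile s) y (EuclideanSpace.single 2 1) 1 ≠
          m * fderiv ℝ (triProfile s) y (EuclideanSpace.single 1 1) 2 := by
  refine ⟨(cellAmp s)⁻¹ • ((Real.pi / 2) • (EuclideanSpace.single (0 : Fin 3) (1 : ℝ)) - Real.log (-s) •
      (EuclideanSpace.single (1 : Fin 3) (1 : ℝ))), fun m hm _ => Or.inl ?_⟩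
  intro h
  rw [fderiv_triProfile_apply, fderiv_triProfile_apply, driftShift_invPoint hs, triDeriv_apply_zero,
    triDeriv_apply_two] at h
  have p0 : ((Real.pi / 2) • (EuclideanSpace.single (0 : Fin 3) (1 : ℝ)) : EuclideanSpace ℝ (Fin 3)) 0 =
      Real.pi / 2 := by simp
  have p1 : ((Real.pi / 2) • (EuclideanSpace.single (0 : Fin 3) (1 : ℝ)) : EuclideanSpace ℝ (Fin 3)) 1 = 0 := by
    simp
  have p2 : ((Real.pi / 2) • (EuclideanSpace.single (0 : Fin 3) (1 : ℝ)) : EuclideanSpace ℝ (Fin 3)) 2 = 0 := by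
    simp
  have e20 : (EuclideanSpace.single (2 : Fin 3) (1 : ℝ) : EuclideanSpace ℝ (Fin 3)) 0 = 0 := by simp
  have e22 : (EuclideanSpace.single (2 : Fin 3) (1 : ℝ) : EuclideanSpace ℝ (Fin 3)) 2 = 1 := by simp
  have e00 : (EuclideanSpace.single (0 : Fin 3) (1 : ℝ) : EuclideanSpace ℝ (Fin 3)) 0 = 1 := by simp
  have e01 : (EuclideanSpace.single (0 : Fin 3) (1 : ℝ) : EuclideanSpace ℝ (Fin 3)) 1 = 0 := by simp
  have e02 : (EuclideanSpace.single (0 : Fin 3) (1 : ℝ) : EuclideanSpace ℝ (Fin 3)) 2 = 0 := by simp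
  simp only [p0, p1, p2, e20, e22, e00, e01, e02, add_zero, sub_zero, zero_add, Real.sin_pi_div_two, Real.sin_zero,
    mul_zero, mul_one] at h
  have hc : 0 < cellAmp s ^ 2 := pow_pos (cellAmp_pos hs) 2
  have hm0 : 0 < m := hμ₀.trans_le hm
  nlinarith [mul_pos hm0 hc]

/-- (9) `v·e₂` is flat in no horizontal direction: `⟪Dv(s) a, e₂⟫ = (−s)^{-1}(2a₀ sin u + 2a₁(sin p − sin w))` is
`2(−s)^{-1}a₀` at `u = π/2, w = p = 0` and `4(−s)^{-1}a₁` at `u = 0, w = −π/2, p = π/2`. [folklore] -/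
theorem flat_in_no_horizontal_direction_triProfile {s : ℝ} (hs : s < 0) (a : EuclideanSpace ℝ (Fin 3)) (ha : a ≠ 0)
    (ha2 : ⟪a, (EuclideanSpace.single (2 : Fin 3) (1 : ℝ))⟫_ℝ = 0) : ∃ x : EuclideanSpace ℝ (Fin 3), ⟪fderiv ℝ
        (triProfile s) x a, (EuclideanSpace.single (2 : Fin 3) (1 : ℝ))⟫_ℝ ≠ 0 := by
  have hc := (cellAmp_pos hs).ne'
  have ha2' : a 2 = 0 := by simpa [EuclideanSpace.inner_single_right] using ha2
  by_cases h0 : a 0 = 0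
  · have h1 : a 1 ≠ 0 := by
      intro h1
      apply ha
      ext i
      fin_cases i
      · exact h0
      · exact h1
      · exact ha2'
    refine ⟨(cellAmp s)⁻¹ • (((-(Real.pi / 2)) • (EuclideanSpace.single (0 : Fin 3) (1 : ℝ)) + (Real.pi / 2) •
        (EuclideanSpace.single (2 : Fin 3) (1 : ℝ))) - Real.log (-s) • (EuclideanSpace.single (1 : Fin 3) (1 : ℝ))),
            ?_⟩
    rw [EuclideanSpace.inner_single_right, fderiv_triProfile_apply, driftShift_invPoint hs, triDeriv_apply_two]
    have p0 : ((-(Real.pi / 2)) • (EuclideanSpace.single (0 : Fin 3) (1 : ℝ)) + (Real.pi / 2) •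
        (EuclideanSpace.single (2 : Fin 3) (1 : ℝ)) : EuclideanSpace ℝ (Fin 3)) 0 = -(Real.pi / 2) := by simp
    have p1 : ((-(Real.pi / 2)) • (EuclideanSpace.single (0 : Fin 3) (1 : ℝ)) + (Real.pi / 2) •
        (EuclideanSpace.single (2 : Fin 3) (1 : ℝ)) : EuclideanSpace ℝ (Fin 3)) 1 = 0 := by simp
    have p2 : ((-(Real.pi / 2)) • (EuclideanSpace.single (0 : Fin 3) (1 : ℝ)) + (Real.pi / 2) •
        (EuclideanSpace.single (2 : Fin 3) (1 : ℝ)) : EuclideanSpace ℝ (Fin 3)) 2 = Real.pi / 2 := by simp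
    simp only [p0, p1, p2, ha2', h0, zero_add, zero_sub, add_zero, sub_zero, neg_add_cancel, Real.sin_zero,
      Real.sin_neg, Real.sin_pi_div_two]
    norm_num
    exact ⟨hc, h1⟩
  · refine ⟨(cellAmp s)⁻¹ • ((Real.pi / 2) • (EuclideanSpace.single (0 : Fin 3) (1 : ℝ)) - Real.log (-s) •
      (EuclideanSpace.single (1 : Fin 3) (1 : ℝ))), ?_⟩
    rw [EuclideanSpace.inner_single_right, fderiv_triProfile_apply, driftShift_invPoint hs, triDeriv_apply_two]
    have p0 : ((Real.pi / 2) • (EuclideanSpace.single (0 : Fin 3) (1 : ℝ)) : EuclideanSpace ℝ (Fin 3)) 0 = Real.pi /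
        2 := by simp
    have p1 : ((Real.pi / 2) • (EuclideanSpace.single (0 : Fin 3) (1 : ℝ)) : EuclideanSpace ℝ (Fin 3)) 1 = 0 := by
        simp
    have p2 : ((Real.pi / 2) • (EuclideanSpace.single (0 : Fin 3) (1 : ℝ)) : EuclideanSpace ℝ (Fin 3)) 2 = 0 := by
        simp
    simp only [p0, p1, p2, ha2', add_zero, sub_zero, Real.sin_zero, Real.sin_pi_div_two]
    norm_num
    exact ⟨hc, h0⟩

/-- (iv) super-critical horizontal strain somewhere: at `(−1, −(π/2)e₀)` with `a = e₀`, `(−s)⟪Dv a, a⟫ = 2 > Λ‖a‖²`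
for every `Λ < 1` (indeed `< 2`). [folklore] -/
theorem triProfile_supercritical_strain (Λ : ℝ) (hΛ : Λ < 1) :
    ∃ s < 0, ∃ (y a : EuclideanSpace ℝ (Fin 3)), ⟪a, (EuclideanSpace.single (2 : Fin 3) (1 : ℝ))⟫_ℝ = 0 ∧ Λ * ‖a‖ ^ 2
        < (-s) * ⟪fderiv ℝ (triProfile s) y a, a⟫_ℝ := by
  refine ⟨-1, by norm_num, (-(Real.pi / 2)) • (EuclideanSpace.single (0 : Fin 3) (1 : ℝ)), (EuclideanSpace.single (0
      : Fin 3) (1 : ℝ)), ?_, ?_⟩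
  · rw [EuclideanSpace.inner_single_left]
    simp
  rw [triProfile_neg_one, fderiv_triField, EuclideanSpace.inner_single_right, triDeriv_apply_zero]
  have p0 : ((-(Real.pi / 2)) • (EuclideanSpace.single (0 : Fin 3) (1 : ℝ)) : EuclideanSpace ℝ (Fin 3)) 0 = -(Real.pi
      / 2) := by simp
  have p2 : ((-(Real.pi / 2)) • (EuclideanSpace.single (0 : Fin 3) (1 : ℝ)) : EuclideanSpace ℝ (Fin 3)) 2 = 0 := by
      simp
  have e00 : (EuclideanSpace.single (0 : Fin 3) (1 : ℝ) : EuclideanSpace ℝ (Fin 3)) 0 = 1 := by simp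
  have e02 : (EuclideanSpace.single (0 : Fin 3) (1 : ℝ) : EuclideanSpace ℝ (Fin 3)) 2 = 0 := by simp
  have hn : ‖(EuclideanSpace.single (0 : Fin 3) (1 : ℝ) : EuclideanSpace ℝ (Fin 3))‖ = 1 := by simp
  simp only [p0, p2, e00, e02, hn, add_zero, Real.sin_neg, Real.sin_pi_div_two]
  norm_num
  linarith

/-- (12) not scale-invariant: `2 v(−4, 0) ≠ v(−1, 0)` — second components `4cos(log 4)` and `4`, `0 < log 4 < 2π`.
[folklore] -/
theorem not_scaleInvariant_triProfile :
    (2 : ℝ) • triProfile ((2 : ℝ) ^ 2 * (-1)) ((2 : ℝ) • (0 : EuclideanSpace ℝ (Fin 3))) ≠ triProfile (-1) 0 := by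
  intro h
  have h1 := congrArg (fun w : EuclideanSpace ℝ (Fin 3) => w 1) h
  have hsqrt : Real.sqrt 4 = 2 := by
    rw [show (4 : ℝ) = 2 ^ 2 by norm_num, Real.sqrt_sq (by norm_num)]
  have h4 : (2 : ℝ) ^ 2 * (-1) = -4 := by norm_num
  rw [h4] at h1
  simp [triProfile, driftShift, cellAmp, triField_apply_one, hsqrt] at h1
  have hlog4 : Real.log 4 ≠ 0 := Real.log_ne_zero_of_pos_of_ne_one (by norm_num) (by norm_num)
  have hlt : Real.log 4 < 2 * Real.pi := by
    have := Real.log_le_sub_one_of_pos (show (0 : ℝ) < 4 by norm_num)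
    linarith [Real.pi_gt_three]
  have hgt : -(2 * Real.pi) < Real.log 4 := by
    have := Real.log_pos (show (1 : ℝ) < 4 by norm_num)
    linarith [Real.pi_pos]
  have hcos : Real.cos (Real.log 4) = 1 := by linarith [Real.cos_le_one (Real.log 4)]
  exact hlog4 ((Real.cos_eq_one_iff_of_lt_of_lt hgt hlt).1 hcos)

/-! ### Translations: the period lattice of `T` meets every line only discretely -/

/-- `T(m ℓ) = T(0)` for all real `m` forces `ℓ = 0`: the first component gives `cos(m(ℓ₀+ℓ₂)) = 1`, the second
`cos(m(ℓ₁−ℓ₂)) + cos(m(ℓ₁+ℓ₂)) = 2`; a half period along a nonzero combination kills a cosine. [folklore] -/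
theorem eq_zero_of_triField_smul_eq (ℓ : EuclideanSpace ℝ (Fin 3)) (key : ∀ m : ℝ, triField (m • ℓ) = triField 0) : ℓ
    = 0 := by
  have cos_le := Real.cos_le_one
  have hα : ℓ 0 + ℓ 2 = 0 := by
    by_contra hα
    have h := congrArg (fun w : EuclideanSpace ℝ (Fin 3) => w 0) (key (Real.pi / (ℓ 0 + ℓ 2)))
    simp only [triField_apply_zero, PiLp.smul_apply, smul_eq_mul, PiLp.zero_apply, add_zero, Real.cos_zero] at h
    have e : Real.pi / (ℓ 0 + ℓ 2) * ℓ 0 + Real.pi / (ℓ 0 + ℓ 2) * ℓ 2 = Real.pi := by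
      rw [← mul_add, div_mul_cancel₀ _ hα]
    rw [e, Real.cos_pi] at h
    norm_num at h
  have hβ : ℓ 1 - ℓ 2 = 0 := by
    by_contra hβ
    have h := congrArg (fun w : EuclideanSpace ℝ (Fin 3) => w 1) (key (Real.pi / (ℓ 1 - ℓ 2)))
    simp only [triField_apply_one, PiLp.smul_apply, smul_eq_mul, PiLp.zero_apply, add_zero, sub_zero,
      Real.cos_zero] at h
    have e : Real.pi / (ℓ 1 - ℓ 2) * ℓ 1 - Real.pi / (ℓ 1 - ℓ 2) * ℓ 2 = Real.pi := by
      rw [← mul_sub, div_mul_cancel₀ _ hβ]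
    rw [e, Real.cos_pi] at h
    linarith [cos_le (Real.pi / (ℓ 1 - ℓ 2) * ℓ 1 + Real.pi / (ℓ 1 - ℓ 2) * ℓ 2)]
  have hγ : ℓ 1 + ℓ 2 = 0 := by
    by_contra hγ
    have h := congrArg (fun w : EuclideanSpace ℝ (Fin 3) => w 1) (key (Real.pi / (ℓ 1 + ℓ 2)))
    simp only [triField_apply_one, PiLp.smul_apply, smul_eq_mul, PiLp.zero_apply, add_zero, sub_zero,
      Real.cos_zero] at h
    have e : Real.pi / (ℓ 1 + ℓ 2) * ℓ 1 + Real.pi / (ℓ 1 + ℓ 2) * ℓ 2 = Real.pi := by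
      rw [← mul_add, div_mul_cancel₀ _ hγ]
    rw [e, Real.cos_pi] at h
    linarith [cos_le (Real.pi / (ℓ 1 + ℓ 2) * ℓ 1 - Real.pi / (ℓ 1 + ℓ 2) * ℓ 2)]
  ext i
  fin_cases i
  · show ℓ 0 = 0
    linarith
  · show ℓ 1 = 0
    linarith
  · show ℓ 2 = 0
    linarith

/-- (10) invariant under no spatial translation on any slice. [folklore] -/
theorem not_translationInvariant_triProfile {s : ℝ} (hs : s < 0) (e : EuclideanSpace ℝ (Fin 3)) (he : e ≠ 0) :
    ∃ (x : EuclideanSpace ℝ (Fin 3)) (l : ℝ), triProfile s (x + l • e) ≠ triProfile s x := by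
  by_contra hcon
  push Not at hcon
  have hc := (cellAmp_pos hs).ne'
  refine he (eq_zero_of_triField_smul_eq e fun m => ?_)
  have h := hcon ((cellAmp s)⁻¹ • ((0 : EuclideanSpace ℝ (Fin 3)) - Real.log (-s) • (EuclideanSpace.single (1 : Fin
      3) (1 : ℝ)))) (m / cellAmp s)
  unfold triProfile at h
  rw [driftShift_add_smul, driftShift_invPoint hs, zero_add] at h
  have hl : cellAmp s * (m / cellAmp s) = m := by field_simp
  rw [hl] at h
  exact smul_right_injective _ hc h

/-- A common period `ℓ` of all slices is a period `m ℓ` of `T` for every real `m` (slice `s = −1/c²` has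
amplitude `c`). [folklore] -/
theorem triField_translate_of_common_period {ℓ : EuclideanSpace ℝ (Fin 3)}
    (hper : ∀ s < 0, ∀ y : EuclideanSpace ℝ (Fin 3), triProfile s (y + ℓ) = triProfile s y) (m : ℝ) :
    triField (m • ℓ) = triField 0 := by
  have pos : ∀ c : ℝ, 0 < c → ∀ z : EuclideanSpace ℝ (Fin 3), triField (z + c • ℓ) = triField z := by
    intro c hc z
    have hs : -(c ^ 2)⁻¹ < (0 : ℝ) := by
      have : 0 < (c ^ 2)⁻¹ := by positivity
      linarith
    have hamp := cellAmp_neg_inv_sq hc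
    have h := hper _ hs ((cellAmp (-(c ^ 2)⁻¹))⁻¹ • (z - Real.log (-(-(c ^ 2)⁻¹)) • (EuclideanSpace.single (1 : Fin
        3) (1 : ℝ))))
    unfold triProfile at h
    rw [← one_smul ℝ ℓ, driftShift_add_smul, driftShift_invPoint hs, hamp, mul_one] at h
    exact smul_right_injective _ hc.ne' h
  rcases lt_trichotomy m 0 with hm | hm | hm
  · have h := pos (-m) (by linarith) (m • ℓ)
    rw [← add_smul, add_neg_cancel, zero_smul] at h
    exact h.symm
  · rw [hm, zero_smul]
  · have h := pos m hm 0
    rwa [zero_add] at h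

/-- (v′) no common spatial period: for every `ℓ ≠ 0` some slice is moved by `y ↦ y + ℓ`. [folklore] -/
theorem triProfile_no_common_period (ℓ : EuclideanSpace ℝ (Fin 3)) (hℓ : ℓ ≠ 0) :
    ∃ s < 0, ∃ y : EuclideanSpace ℝ (Fin 3), triProfile s (y + ℓ) ≠ triProfile s y := by
  by_contra h
  push Not at h
  exact hℓ (eq_zero_of_triField_smul_eq ℓ (triField_translate_of_common_period h))

/-- (13) no common vertical period. [folklore] -/
theorem triProfile_no_vertical_period (L : ℝ) (hL : 0 < L) :
    ∃ s < 0, ∃ y : EuclideanSpace ℝ (Fin 3), triProfile s (y + L • (EuclideanSpace.single (2 : Fin 3) (1 : ℝ))) ≠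
        triProfile s y := by
  refine triProfile_no_common_period (L • (EuclideanSpace.single (2 : Fin 3) (1 : ℝ))) ?_
  intro h
  have := congrArg (fun w : EuclideanSpace ℝ (Fin 3) => w 2) h
  simp [hL.ne'] at this


end Summit.NavierStokesRegularity.NavierStokesRegularity.Theorems.PoloidalWindowRigidity.Negative

end
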